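import Summits.Ventures.CertifiedArithmetic.LowPrec.OptTreePolyFormats
import Summits.Ventures.CertifiedArithmetic.LowPrec.AccumulateRange

/-!
# T4 in the formats with a DATA-ONLY range hypothesis

HONEST FRAMING (venture CertifiedArithmetic / cell `pub-lowprec`): certified error envelopes and
provably optimal rounding/accumulation schemes for low-precision formats under stated cost models;
every table by two implementations; no hardware or vendor claims.

`OptTreePolyFormats.exact_sub_eval_le_format` (OPTIMA Theorem T4(a) in every format) carries the
standing per-node hypothesis `TreeInRange α t`. With the lean seat's a-priori range discharge
`treeInRange_of_absSum_le` (`AccumulateRange.lean`: leaves values of `α`, `emaxCode ≥ 2`,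
`(1 + (n-1)·u/(1+u))·Σ|xᵢ| ≤ maxRat α` ⟹ every node in range) the hypothesis becomes a single
inequality on the DATA: `exact_sub_eval_le_format_of_absSum_le`. For nonnegative data `Σ|xᵢ|` is the
exact sum, so the condition reads `(1 + (n-1)u/(1+u))·s ≤ maxRat α`.
-/

namespace Summit.Ventures.CertifiedArithmetic.LowPrec.Opt

open Literature.ComputerArithmetic.JeannerodRump2018
open Literature.ComputerArithmetic.JeannerodRump2018.SumTree
open Literature.ComputerArithmetic.FloatingPoint
open Literature.ComputerArithmetic.FloatingPoint.MiniFloat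

/-- **T4(a) IN FORMAT `α`, DATA-ONLY FORM**: leaves nonnegative values of `α` (`emaxCode ≥ 2`) with
`(1 + (n-1)·u/(1+u))·Σ|xᵢ| ≤ maxRat α` ⟹ for every evaluation tree the format's RNE sum satisfies
`exact - computed ≤ (1 - 1/M_t(u_α))·exact`. -/
theorem exact_sub_eval_le_format_of_absSum_le (α : Format) (hα : 2 ≤ α.emaxCode) (t : SumTree)
    (ht : ∀ x ∈ leaves t, (∃ y : MiniFloat α, y.toRat = x) ∧ 0 ≤ x)
    (hrange : (1 + (((leaves t).length : ℚ) - 1) * (α.unitRoundoff / (1 + α.unitRoundoff)))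
      * absSum t ≤ α.maxRat) :
    exact t - eval (flα α) t ≤ (1 - 1 / treeM α.unitRoundoff t) * exact t :=
  exact_sub_eval_le_format α t
    (treeInRange_of_absSum_le hα t (fun x hx => (ht x hx).1) hrange) (fun x hx => (ht x hx).2)

/-- The same with the bound form `exact ≤ M_t(u_α)·computed`. -/
theorem exact_le_treeM_mul_eval_format_of_absSum_le (α : Format) (hα : 2 ≤ α.emaxCode)
    (t : SumTree) (ht : ∀ x ∈ leaves t, (∃ y : MiniFloat α, y.toRat = x) ∧ 0 ≤ x)
    (hrange : (1 + (((leaves t).length : ℚ) - 1) * (α.unitRoundoff / (1 + α.unitRoundoff)))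
      * absSum t ≤ α.maxRat) :
    exact t ≤ treeM α.unitRoundoff t * eval (flα α) t :=
  exact_le_treeM_mul_eval_format α t
    (treeInRange_of_absSum_le hα t (fun x hx => (ht x hx).1) hrange) (fun x hx => (ht x hx).2)

/-- For nonnegative leaves the mass `Σ|xᵢ|` is the exact sum. -/
theorem absSum_eq_exact_of_nonneg : ∀ t : SumTree, (∀ x ∈ leaves t, 0 ≤ x) → absSum t = exact t
  | .leaf x, h => by
      have hx := h x (by simp [leaves])
      simp [absSum, exact, leaves, abs_of_nonneg hx]
  | .node l r, h => by
      rw [absSum_node]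
      simp only [exact]
      rw [absSum_eq_exact_of_nonneg l (fun x hx => h x (by simp [leaves, hx])),
        absSum_eq_exact_of_nonneg r (fun x hx => h x (by simp [leaves, hx]))]

/-- Data-only T4(a) in format `α` stated on the exact sum: nonnegative `α`-values,
`(1 + (n-1)u/(1+u))·s ≤ maxRat α` ⟹ `s - ŝ ≤ (1 - 1/M_t(u_α))·s` for every tree. -/
theorem exact_sub_eval_le_format_of_exact_le (α : Format) (hα : 2 ≤ α.emaxCode) (t : SumTree)
    (ht : ∀ x ∈ leaves t, (∃ y : MiniFloat α, y.toRat = x) ∧ 0 ≤ x)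
    (hrange : (1 + (((leaves t).length : ℚ) - 1) * (α.unitRoundoff / (1 + α.unitRoundoff)))
      * exact t ≤ α.maxRat) :
    exact t - eval (flα α) t ≤ (1 - 1 / treeM α.unitRoundoff t) * exact t := by
  refine exact_sub_eval_le_format_of_absSum_le α hα t ht ?_
  rwa [absSum_eq_exact_of_nonneg t (fun x hx => (ht x hx).2)]

end Summit.Ventures.CertifiedArithmetic.LowPrec.Opt
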